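import Mathlib
import Summits.SmoothPoincare4.SmoothPoincare4.Theorems.SoloInformedSectionSurgery
import Summits.SmoothPoincare4.SmoothPoincare4.Theorems.SoloInformedBinaryIcosahedral

/-!
# The binary icosahedral input of the Poincaré-sphere trick, II: `A₅`-orders, the nine classes,
# and the capstone "killing class ⟺ non-central"

Solo residency `solo-SmoothPoincare4-informed`, session 109 (HOME `paper/paper.md`, Part I:
Lemma 2.2′, Cor. A′(ii)/Thm. B, Prop. 11.2 (ii)–(iii) of the long draft; CLAIMS C719–C723).
Continues `SoloInformedBinaryIcosahedral` (structure of `I* = SL(2, 𝔽₅)`):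

* `exists_a5Order`, `x_pow_mem_center_iff` (`y_…`, `z_…`) — the "A₅-order" `d ∈ {2, 3, 5}` of a
  non-central element (least `d ≥ 1` with `g^d` central): `2` on the class of `x`, `3` on the
  classes of `y, y²`, `5` on the classes of `z, z², z³, z⁴`, and `g^q` is central iff `d ∣ q`
  (the criterion "`Σ_q(Σ, U)` is simply connected iff `ord(ḡ) ∤ q`" of Cor. A′(ii)/Thm. B);
  `sq_mem_center_iff_isConj_x` — `g²` is central exactly on the class of `x`;
* `eq_of_isConj_of_mem_classReps`, `exists_classRep_isConj`, `card_conjClasses` — the NINE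
  conjugacy classes `1, -1, [x], [y], [y²], [z], [z²], [z³], [z⁴]` (complete and irredundant;
  `Nat.card (ConjClasses SL(2, 𝔽₅)) = 9`), i.e. the nine section classes of `P × S¹ → S¹`
  (`SectionSurgery.twistedConj_iff_isConj`); the class lists `classTable` are certified as ORBITS
  through `listNormalizer` — a list stable under conjugation by `x^{±1}, y^{±1}` is stable under
  the group they generate, which is everything — so no conjugator is enumerated;
* `killing_iff_not_mem_center`, `killing_iff_ne_one_and_ne_neg_one` — the CAPSTONE, Lemma 2.2′ of
  the paper at kernel level: for every `g ∈ SL(2, 𝔽₅)`,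
  `normalClosure {⁅y, g⁆ : y} = ⊤ ↔ g ∉ Z(I*) ↔ g ≠ ±1`, by instantiating the landed abstract
  theorem `SectionSurgery.normalClosure_commutators_eq_top_iff` with `commutator_eq_top` and
  `normal_le_center_or_eq_top`; its section-surgery form `sectionSurgery_killing_iff` /
  `productSurgery_killing_iff` (surgery on the mapping torus of `μ_q` along the section class
  `w·t` is simply connected iff `w q ≠ ±1`); `killed_eq_bot_of_central` (the central classes kill
  nothing: `π₁ = I*`); `surgery_class_exhaustion` (the killing classes are the `(e_k^j, 1)`,
  `k ∈ {2,3,5}`, `j` prime to `k` — the classes of the branched twist spins, Lemma `T_P`).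

Topological reading (prose, not formalised; paper §2–§3): `π₁ X(P × S¹; (g,1), f) = I*/N_g` with
`N_g` the normal closure of `{⁅y,g⁆}`, so the surgered manifold is simply connected iff `g ≠ ±1`.
-/

namespace Summit.SmoothPoincare4.SmoothPoincare4.Theorems
namespace BinaryIcosahedral

open Matrix MatrixGroups Subgroup
open scoped commutatorElement

/-! ### The `A₅`-order of a non-central element -/

/-- Central powers are a conjugacy invariant. -/
theorem pow_mem_center_iff_of_isConj {r g : SL(2, ZMod 5)} (h : IsConj r g) (q : ℕ) :
    g ^ q ∈ center (SL(2, ZMod 5)) ↔ r ^ q ∈ center (SL(2, ZMod 5)) := by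
  obtain ⟨c, rfl⟩ := isConj_iff.mp h
  rw [conj_pow]
  constructor
  · intro hc
    have h' := (center (SL(2, ZMod 5))).normal_of_characteristic.conj_mem _ hc c⁻¹
    simpa [mul_assoc] using h'
  · intro hr
    exact (center (SL(2, ZMod 5))).normal_of_characteristic.conj_mem _ hr c

/-- Powers of `x` below the order: `x^q` is central iff `2 ∣ q` (`q < 4`). -/
theorem x_pow_mem_center_iff_lt : ∀ q < 4, (x ^ q = 1 ∨ x ^ q = -1) ↔ 2 ∣ q := by decide
/-- Powers of `y` below the order: `y^q` is central iff `3 ∣ q` (`q < 6`). -/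
theorem y_pow_mem_center_iff_lt : ∀ q < 6, (y ^ q = 1 ∨ y ^ q = -1) ↔ 3 ∣ q := by decide +kernel
/-- Powers of `z` below the order: `z^q` is central iff `5 ∣ q` (`q < 10`). -/
theorem z_pow_mem_center_iff_lt : ∀ q < 10, (z ^ q = 1 ∨ z ^ q = -1) ↔ 5 ∣ q := by decide +kernel

/-- `x^q` is central iff `2 ∣ q`: the `A₅`-order of `x` is `2`. -/
theorem x_pow_mem_center_iff (q : ℕ) : x ^ q ∈ center (SL(2, ZMod 5)) ↔ 2 ∣ q := by
  rw [mem_center_iff, ← pow_mod_orderOf, orderOf_x,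
    x_pow_mem_center_iff_lt _ (Nat.mod_lt _ (by norm_num))]
  omega

/-- `y^q` is central iff `3 ∣ q`: the `A₅`-order of `y` is `3`. -/
theorem y_pow_mem_center_iff (q : ℕ) : y ^ q ∈ center (SL(2, ZMod 5)) ↔ 3 ∣ q := by
  rw [mem_center_iff, ← pow_mod_orderOf, orderOf_y,
    y_pow_mem_center_iff_lt _ (Nat.mod_lt _ (by norm_num))]
  omega

/-- `z^q` is central iff `5 ∣ q`: the `A₅`-order of `z` is `5`. -/
theorem z_pow_mem_center_iff (q : ℕ) : z ^ q ∈ center (SL(2, ZMod 5)) ↔ 5 ∣ q := by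
  rw [mem_center_iff, ← pow_mod_orderOf, orderOf_z,
    z_pow_mem_center_iff_lt _ (Nat.mod_lt _ (by norm_num))]
  omega

/-- `(y²)^q` is central iff `3 ∣ q`. -/
theorem y_sq_pow_mem_center_iff (q : ℕ) : (y ^ 2) ^ q ∈ center (SL(2, ZMod 5)) ↔ 3 ∣ q := by
  rw [← pow_mul, y_pow_mem_center_iff]; omega

/-- `(z^k)^q` is central iff `5 ∣ q`, for `k = 2, 3, 4`. -/
theorem z_pow_pow_mem_center_iff {k : ℕ} (hk : k = 2 ∨ k = 3 ∨ k = 4) (q : ℕ) :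
    (z ^ k) ^ q ∈ center (SL(2, ZMod 5)) ↔ 5 ∣ q := by
  rw [← pow_mul, z_pow_mem_center_iff]
  rcases hk with rfl | rfl | rfl <;> omega

/-- THE `A₅`-ORDER (Cor. A′(ii), Thm. B of the paper): every non-central `g ∈ I*` has a well-defined
`d ∈ {2, 3, 5}` — the order of its image in `A₅ = I*/{±1}` — such that `g^q` is central iff `d ∣ q`;
`d = 2, 3, 5` according as `g` is conjugate to a power of `x`, `y`, `z`. -/
theorem exists_a5Order {g : SL(2, ZMod 5)} (hg : g ∉ center (SL(2, ZMod 5))) :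
    ∃ d : ℕ, (d = 2 ∨ d = 3 ∨ d = 5) ∧ ∀ q : ℕ, g ^ q ∈ center (SL(2, ZMod 5)) ↔ d ∣ q := by
  obtain ⟨r, hr, hc⟩ := exists_rep_isConj hg
  simp_rw [pow_mem_center_iff_of_isConj hc]
  rw [mem_reps_iff] at hr
  rcases hr with rfl | rfl | rfl | rfl | rfl | rfl | rfl
  · exact ⟨2, by norm_num, x_pow_mem_center_iff⟩
  · exact ⟨3, by norm_num, y_pow_mem_center_iff⟩
  · exact ⟨3, by norm_num, y_sq_pow_mem_center_iff⟩
  · exact ⟨5, by norm_num, z_pow_mem_center_iff⟩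
  · exact ⟨5, by norm_num, z_pow_pow_mem_center_iff (by norm_num)⟩
  · exact ⟨5, by norm_num, z_pow_pow_mem_center_iff (by norm_num)⟩
  · exact ⟨5, by norm_num, z_pow_pow_mem_center_iff (by norm_num)⟩

/-- The square of a non-central `g` is central exactly on the class of `x` (the `A₅`-involutions);
used in the paper as: `A₅`-order `≠ 2` ⇒ the `2`-fold cover `Σ₂` is simply connected. -/
theorem sq_mem_center_iff_isConj_x {g : SL(2, ZMod 5)} (hg : g ∉ center (SL(2, ZMod 5))) :
    g ^ 2 ∈ center (SL(2, ZMod 5)) ↔ IsConj x g := by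
  obtain ⟨r, hr, hc⟩ := exists_rep_isConj hg
  rw [pow_mem_center_iff_of_isConj hc]
  have hx2 : x ^ 2 ∈ center (SL(2, ZMod 5)) := (x_pow_mem_center_iff 2).mpr (dvd_refl 2)
  have key : IsConj x g → r ^ 2 ∈ center (SL(2, ZMod 5)) := fun hx =>
    ((pow_mem_center_iff_of_isConj hx 2).symm.trans (pow_mem_center_iff_of_isConj hc 2)).mp hx2
  have h3 : ¬ (3 ∣ 2) := by decide
  have h5 : ¬ (5 ∣ 2) := by decide
  rw [mem_reps_iff] at hr
  rcases hr with rfl | rfl | rfl | rfl | rfl | rfl | rfl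
  · exact ⟨fun _ => hc, fun _ => hx2⟩
  · exact ⟨fun h => absurd ((y_pow_mem_center_iff 2).mp h) h3,
      fun h => absurd ((y_pow_mem_center_iff 2).mp (key h)) h3⟩
  · exact ⟨fun h => absurd ((y_sq_pow_mem_center_iff 2).mp h) h3,
      fun h => absurd ((y_sq_pow_mem_center_iff 2).mp (key h)) h3⟩
  · exact ⟨fun h => absurd ((z_pow_mem_center_iff 2).mp h) h5,
      fun h => absurd ((z_pow_mem_center_iff 2).mp (key h)) h5⟩
  · exact ⟨fun h => absurd ((z_pow_pow_mem_center_iff (k := 2) (by norm_num) 2).mp h) h5,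
      fun h => absurd ((z_pow_pow_mem_center_iff (k := 2) (by norm_num) 2).mp (key h)) h5⟩
  · exact ⟨fun h => absurd ((z_pow_pow_mem_center_iff (k := 3) (by norm_num) 2).mp h) h5,
      fun h => absurd ((z_pow_pow_mem_center_iff (k := 3) (by norm_num) 2).mp (key h)) h5⟩
  · exact ⟨fun h => absurd ((z_pow_pow_mem_center_iff (k := 4) (by norm_num) 2).mp h) h5,
      fun h => absurd ((z_pow_pow_mem_center_iff (k := 4) (by norm_num) 2).mp (key h)) h5⟩

/-! ### The nine conjugacy classes

The class lists `classTable` are certified as ORBITS without enumerating conjugators: a list stable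
under conjugation by `x^{±1}` and `y^{±1}` is stable under the subgroup they generate, which is
everything. -/

/-- Membership in `listNormalizer l`, unfolded. -/
theorem mem_listNormalizer_iff {l : List (SL(2, ZMod 5))} {c : SL(2, ZMod 5)} :
    c ∈ listNormalizer l ↔ ∀ s ∈ l, c * s * c⁻¹ ∈ l ∧ c⁻¹ * s * c ∈ l := Iff.rfl

/-- A list normalised by `x` and `y` is normalised by everything. -/
theorem conj_mem_of_mem_listNormalizer {l : List (SL(2, ZMod 5))} (hx : x ∈ listNormalizer l)
    (hy : y ∈ listNormalizer l) (c : SL(2, ZMod 5)) {s : SL(2, ZMod 5)} (hs : s ∈ l) :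
    c * s * c⁻¹ ∈ l := by
  have hc : c ∈ listNormalizer l := by rw [eq_top_of_mem hx hy]; exact mem_top c
  exact ((mem_listNormalizer_iff.mp hc) s hs).1

/-- The heads of the class table are the representatives. -/
theorem map_fst_classTable : classTable.map Prod.fst = reps := by decide +kernel

/-- Kernel check: each class list contains its representative and no other representative, and is
stable under conjugation by `x^{±1}` and `y^{±1}` (`4 · 118` conjugations). -/
theorem classTable_check :
    (classTable.all fun p => decide (p.1 ∈ p.2) && p.2.all fun s =>
      decide (x * s * x⁻¹ ∈ p.2 ∧ x⁻¹ * s * x ∈ p.2 ∧ y * s * y⁻¹ ∈ p.2 ∧ y⁻¹ * s * y ∈ p.2 ∧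
        (s ∈ reps → s = p.1))) = true := by
  decide +kernel

/-- Row-wise reading of `classTable_check`. -/
theorem classTable_valid {p : SL(2, ZMod 5) × List (SL(2, ZMod 5))} (hp : p ∈ classTable) :
    p.1 ∈ p.2 ∧ x ∈ listNormalizer p.2 ∧ y ∈ listNormalizer p.2 ∧
      ∀ s ∈ p.2, s ∈ reps → s = p.1 := by
  have h := List.all_eq_true.mp classTable_check p hp
  rw [Bool.and_eq_true] at h
  have h1 : p.1 ∈ p.2 := of_decide_eq_true h.1
  have h2 : ∀ s ∈ p.2, x * s * x⁻¹ ∈ p.2 ∧ x⁻¹ * s * x ∈ p.2 ∧ y * s * y⁻¹ ∈ p.2 ∧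
      y⁻¹ * s * y ∈ p.2 ∧ (s ∈ reps → s = p.1) :=
    fun s hs => of_decide_eq_true (List.all_eq_true.mp h.2 s hs)
  exact ⟨h1, mem_listNormalizer_iff.mpr fun s hs => ⟨(h2 s hs).1, (h2 s hs).2.1⟩,
    mem_listNormalizer_iff.mpr fun s hs => ⟨(h2 s hs).2.2.1, (h2 s hs).2.2.2.1⟩,
    fun s hs => (h2 s hs).2.2.2.2⟩

/-- Each class list is stable under ALL conjugations (it is the conjugacy class of its head). -/
theorem conj_mem_classTable {p : SL(2, ZMod 5) × List (SL(2, ZMod 5))} (hp : p ∈ classTable)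
    (c : SL(2, ZMod 5)) {s : SL(2, ZMod 5)} (hs : s ∈ p.2) : c * s * c⁻¹ ∈ p.2 := by
  obtain ⟨_, hx, hy, _⟩ := classTable_valid hp
  exact conj_mem_of_mem_listNormalizer hx hy c hs

/-- IRREDUNDANCY: the seven non-central representatives are pairwise non-conjugate. -/
theorem eq_of_isConj_of_mem_reps {r₁ r₂ : SL(2, ZMod 5)} (h₁ : r₁ ∈ reps) (h₂ : r₂ ∈ reps)
    (hc : IsConj r₁ r₂) : r₁ = r₂ := by
  have hmap : r₁ ∈ classTable.map Prod.fst := by rw [map_fst_classTable]; exact h₁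
  obtain ⟨p, hp, rfl⟩ := List.mem_map.mp hmap
  obtain ⟨hp1, _, _, huniq⟩ := classTable_valid hp
  obtain ⟨c, rfl⟩ := isConj_iff.mp hc
  exact (huniq _ (conj_mem_classTable hp c hp1) h₂).symm

/-- A central element is conjugate only to itself. -/
theorem eq_of_isConj_of_mem_center {r g : SL(2, ZMod 5)} (hr : r ∈ center (SL(2, ZMod 5)))
    (h : IsConj r g) : g = r := by
  obtain ⟨c, rfl⟩ := isConj_iff.mp h
  rw [Subgroup.mem_center_iff.mp hr c, mul_inv_cancel_right]

/-- There are nine representatives. -/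
theorem length_classReps : classReps.length = 9 := rfl

/-- COMPLETENESS: every element is conjugate to one of the nine representatives. -/
theorem exists_classRep_isConj (g : SL(2, ZMod 5)) : ∃ r ∈ classReps, IsConj r g := by
  by_cases hg : g ∈ center (SL(2, ZMod 5))
  · rw [mem_center_iff] at hg
    rcases hg with rfl | rfl
    · exact ⟨1, by simp [classReps], IsConj.refl 1⟩
    · exact ⟨-1, by simp [classReps], IsConj.refl (-1)⟩
  · obtain ⟨r, hr, hc⟩ := exists_rep_isConj hg
    exact ⟨r, List.mem_cons_of_mem _ (List.mem_cons_of_mem _ hr), hc⟩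

/-- IRREDUNDANCY: the nine representatives are pairwise non-conjugate. -/
theorem eq_of_isConj_of_mem_classReps {r₁ r₂ : SL(2, ZMod 5)} (h₁ : r₁ ∈ classReps)
    (h₂ : r₂ ∈ classReps) (hc : IsConj r₁ r₂) : r₁ = r₂ := by
  have c1 : (1 : SL(2, ZMod 5)) ∈ center (SL(2, ZMod 5)) := Subgroup.one_mem _
  have cn : (-1 : SL(2, ZMod 5)) ∈ center (SL(2, ZMod 5)) := (mem_center_iff _).mpr (Or.inr rfl)
  simp only [classReps, List.mem_cons] at h₁ h₂
  rcases h₁ with rfl | rfl | h₁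
  · exact (eq_of_isConj_of_mem_center c1 hc).symm
  · exact (eq_of_isConj_of_mem_center cn hc).symm
  · rcases h₂ with rfl | rfl | h₂
    · exact eq_of_isConj_of_mem_center c1 hc.symm
    · exact eq_of_isConj_of_mem_center cn hc.symm
    · exact eq_of_isConj_of_mem_reps h₁ h₂ hc

/-- The vector enumerates `classReps`. -/
theorem repVec_mem (i : Fin 9) : repVec i ∈ classReps := by
  fin_cases i <;> simp [repVec, classReps, reps]

/-- The nine representatives are pairwise distinct. -/
theorem repVec_injective : Function.Injective repVec := by
  intro i j h
  fin_cases i <;> fin_cases j <;> first | rfl | exact absurd h (by decide +kernel)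

/-- Every representative is a value of `repVec`. -/
theorem exists_repVec_eq {r : SL(2, ZMod 5)} (hr : r ∈ classReps) : ∃ i : Fin 9, repVec i = r := by
  simp only [classReps, reps, List.mem_cons, List.not_mem_nil, or_false] at hr
  rcases hr with rfl | rfl | rfl | rfl | rfl | rfl | rfl | rfl | rfl
  exacts [⟨0, rfl⟩, ⟨1, rfl⟩, ⟨2, rfl⟩, ⟨3, rfl⟩, ⟨4, rfl⟩, ⟨5, rfl⟩, ⟨6, rfl⟩, ⟨7, rfl⟩, ⟨8, rfl⟩]

/-- `SL(2, 𝔽₅)` has exactly NINE conjugacy classes. -/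
theorem card_conjClasses : Nat.card (ConjClasses (SL(2, ZMod 5))) = 9 := by
  have hbij : Function.Bijective fun i : Fin 9 => ConjClasses.mk (repVec i) := by
    constructor
    · intro i j hij
      exact repVec_injective (eq_of_isConj_of_mem_classReps (repVec_mem i) (repVec_mem j)
        (ConjClasses.mk_eq_mk_iff_isConj.mp hij))
    · intro C
      obtain ⟨g, rfl⟩ := ConjClasses.mk_surjective C
      obtain ⟨r, hr, hc⟩ := exists_classRep_isConj g
      obtain ⟨i, rfl⟩ := exists_repVec_eq hr
      exact ⟨i, ConjClasses.mk_eq_mk_iff_isConj.mpr hc⟩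
  rw [← Nat.card_eq_of_bijective _ hbij, Nat.card_eq_fintype_card, Fintype.card_fin]

/-! ### Capstone: Lemma 2.2′ of the paper for `P = S³/I*` -/

/-- KILLING CLASS ⟺ NON-CENTRAL, for `I* = SL(2, 𝔽₅)`: the normal closure of the commutators
with `g` (the subgroup of `π₁ P` killed by loop surgery on `P × S¹` along a section-like loop of
class `(g,1)`) is everything iff `g` is not central.  This is
`SectionSurgery.normalClosure_commutators_eq_top_iff` with its two hypotheses DISCHARGED for the
concrete group. -/
theorem killing_iff_not_mem_center (g : SL(2, ZMod 5)) :
    normalClosure (Set.range fun y : SL(2, ZMod 5) => ⁅y, g⁆) = ⊤ ↔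
      g ∉ center (SL(2, ZMod 5)) := by
  haveI := nontrivial
  exact SectionSurgery.normalClosure_commutators_eq_top_iff commutator_eq_top
    normal_le_center_or_eq_top g

/-- The same with the centre made explicit: `π₁ X(P × S¹; (g,1), f) = 1 ⟺ g ≠ ±1` (paper (2.2′)). -/
theorem killing_iff_ne_one_and_ne_neg_one (g : SL(2, ZMod 5)) :
    normalClosure (Set.range fun y : SL(2, ZMod 5) => ⁅y, g⁆) = ⊤ ↔ g ≠ 1 ∧ g ≠ -1 := by
  rw [killing_iff_not_mem_center, mem_center_iff, not_or]

/-- And when `g` IS central the killed subgroup is trivial, so `π₁ = I*` (paper (2.2′), second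
case). -/
theorem killed_eq_bot_of_central {g : SL(2, ZMod 5)} (hg : g = 1 ∨ g = -1) :
    normalClosure (Set.range fun y : SL(2, ZMod 5) => ⁅y, g⁆) = ⊥ :=
  SectionSurgery.normalClosure_commutators_eq_bot_of_mem_center ((mem_center_iff g).mpr hg)

/-- SECTION-SURGERY FORM (paper Lemma 2.2′, `T_P` Step 1): for a mapping torus of `P = S³/I*` with
inner monodromy `μ_q` (`q = 1` is the product `P × S¹`), surgery along the section class `w · t`
yields a simply connected manifold iff `w q ≠ ±1`. -/
theorem sectionSurgery_killing_iff (q w : SL(2, ZMod 5)) :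
    normalClosure (SectionSurgery.sectionRelators (MulAut.conj q).toMonoidHom w) = ⊤ ↔
      w * q ≠ 1 ∧ w * q ≠ -1 := by
  haveI := nontrivial
  rw [SectionSurgery.normalClosure_sectionRelators_conj_eq_top_iff commutator_eq_top
    normal_le_center_or_eq_top q w, mem_center_iff, not_or]

/-- The product `P × S¹` (`q = 1`): the killing section classes are exactly the `118` classes
`w ≠ ±1`, i.e. seven of the nine conjugacy classes (`card_conjClasses`, `classReps`). -/
theorem productSurgery_killing_iff (w : SL(2, ZMod 5)) :
    normalClosure (SectionSurgery.sectionRelators (MulAut.conj 1).toMonoidHom w) = ⊤ ↔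
      w ≠ 1 ∧ w ≠ -1 := by
  rw [sectionSurgery_killing_iff, mul_one]

/-- Exhaustion restated for the surgery classes of Lemma `T_P`: for every `g ≠ ±1` there are
`k ∈ {2,3,5}` and `j` prime to `k` with `g` conjugate to `e_k^j`, `e₂ = x, e₃ = y, e₅ = z`. -/
theorem surgery_class_exhaustion {g : SL(2, ZMod 5)} (hg : g ≠ 1 ∧ g ≠ -1) :
    ∃ k j : ℕ, (k = 2 ∧ ¬ 2 ∣ j ∧ IsConj (x ^ j) g) ∨ (k = 3 ∧ ¬ 3 ∣ j ∧ IsConj (y ^ j) g) ∨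
      (k = 5 ∧ ¬ 5 ∣ j ∧ IsConj (z ^ j) g) := by
  have hg' : g ∉ center (SL(2, ZMod 5)) := by rw [mem_center_iff, not_or]; exact hg
  rcases isConj_pow_x_or_y_or_z hg' with ⟨j, hj, hc⟩ | ⟨j, hj, hc⟩ | ⟨j, hj, hc⟩
  · exact ⟨2, j, Or.inl ⟨rfl, hj, hc⟩⟩
  · exact ⟨3, j, Or.inr (Or.inl ⟨rfl, hj, hc⟩)⟩
  · exact ⟨5, j, Or.inr (Or.inr ⟨rfl, hj, hc⟩)⟩

end BinaryIcosahedral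
end Summit.SmoothPoincare4.SmoothPoincare4.Theorems
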